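import Literature.MathematicalPhysics.QuantumFieldTheory.Chatterjee2026YMHiggs.ProcaKernelAsymptotics
import HarnessLib

/-!
# Chatterjee's mass of the Euclidean Proca field (Lemma 2.6, with Cor. 4.8 and Lemma 4.9) — proofs

S. Chatterjee, *A scaling limit of `SU(2)` lattice Yang–Mills–Higgs theory*, Probab. Math. Phys.
**7** (2026) 339–381, arXiv:2401.10507 [Chatterjee2026YMHiggs], §4.5: **Corollary 4.8**
(`K_λ(x_n + y)/K_λ(x_n) → e^{−√λ u·y}`), **Lemma 4.9**
(`∫ f K_λ g^{x_n} / K_λ(x_n) → I(f, g, u, λ)`) and **Lemma 2.6** (the mass of the Euclidean Proca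
field is `√λ`), following the printed proofs; the kernel asymptotics Lemma 4.7 is the tree's
`kernelK_asymptotics_holds` (`ProcaKernelAsymptotics.lean`), the kernel form of the covariance
`(φ, C_m ψ) = ∫∫ φ(x) K(x − y) ψ(y)` is the tree's `freeCovarianceOp_apply_eq_integral_freeKernel`
(`OSAxiomsFreeFieldKernelProofs.lean`). Theorems only; no new definitions, no new named facts.
-/

noncomputable section

open MeasureTheory Set Filter Topology Bornology Metric
open scoped SchwartzMap RealInnerProductSpace LineDeriv
open Literature.Analysis.UnboundedOperators Literature.MathematicalPhysics.QuantumLattice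

namespace Literature.MathematicalPhysics.QuantumFieldTheory.Chatterjee2026YMHiggs

variable {E : Type*} [NormedAddCommGroup E] [InnerProductSpace ℝ E] [FiniteDimensional ℝ E]
  [MeasurableSpace E] [BorelSpace E]

/-! ### The covariance in kernel form -/

/-- **The free covariance of real test functions in kernel form**:
`C_m(f, g) = ∫ f(x) (∫ K_m(x − y) g(y) dy) dx` (`m ≠ 0`). Chain: Plancherel form
`freeCovariance_eq_integral_mul_op` and `C_m g = K_m ⋆ g` (`freeCovarianceOp_apply_eq_integral_freeKernel`).
[cite: GlimmJaffeQP1987, §7.2 eq. (7.2.1)] -/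
theorem freeCovarianceReal_eq_integral_kernel {m : ℝ} (hm : m ≠ 0) (f g : 𝓢(E, ℝ)) :
    freeCovarianceReal m f g =
      ∫ x, f x * ∫ y, (∫ t in Ioi (0 : ℝ), Real.exp (-m ^ 2 * t) * heatKernel t (x - y)) * g y := by
  rw [freeCovarianceReal, freeCovariance_eq_integral_mul_op hm]
  have e : ∀ x : E, (starRingEnd ℂ) (ofRealTest f x) * freeCovarianceOp m (ofRealTest g) x =
      ((f x * ∫ y, (∫ t in Ioi (0 : ℝ), Real.exp (-m ^ 2 * t) * heatKernel t (x - y)) * g y : ℝ) :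
        ℂ) := by
    intro x
    rw [freeCovarianceOp_apply_eq_integral_freeKernel hm, ofRealTest_apply, Complex.conj_ofReal,
      Complex.ofReal_mul, ← integral_complex_ofReal]
    congr 1
    refine integral_congr_ae (ae_of_all _ fun y => ?_)
    simp only [ofRealTest_apply]
    push_cast
    ring
  simp_rw [e]
  rw [integral_complex_ofReal, Complex.ofReal_re]

/-- The inner kernel integral against a translated test function, `g^a(y) = g(y + a)`:
`∫ K(x − y) g(y + a) dy = ∫ K(v + a) g(x − v) dv` (the printed (4.11): `y − z = v`, `z = v + a`).
[cite: Chatterjee2026YMHiggs, Lemma 4.9 (§4.5, proof, first display)] -/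
theorem integral_kernel_translateTest (m : ℝ) (g : 𝓢(E, ℝ)) (a x : E) :
    ∫ y, (∫ t in Ioi (0 : ℝ), Real.exp (-m ^ 2 * t) * heatKernel t (x - y)) *
        (translateTest (-a) g) y =
      ∫ v, (∫ t in Ioi (0 : ℝ), Real.exp (-m ^ 2 * t) * heatKernel t (v + a)) * g (x - v) := by
  simp only [translateTest_apply, sub_neg_eq_add]
  rw [← integral_sub_left_eq_self (fun y => (∫ t in Ioi (0 : ℝ), Real.exp (-m ^ 2 * t) *
    heatKernel t (x - y)) * g (y + a)) volume (x - a)]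
  refine integral_congr_ae (ae_of_all _ fun v => ?_)
  simp only
  rw [show x - (x - a - v) = v + a by abel, show x - a - v + a = x - v by abel]

/-! ### Corollary 4.8: `K(x_n + y)/K(x_n) → e^{−m u·y}` -/

omit [FiniteDimensional ℝ E] [MeasurableSpace E] [BorelSpace E] in
/-- `‖x_n + y‖ − ‖x_n‖ → u·y` when `‖x_n‖ → ∞` and `x_n/‖x_n‖ → u` (the printed expansion
`‖x + y‖ − ‖x‖ = x·y/‖x‖ + O(‖x‖⁻¹)`). [cite: Chatterjee2026YMHiggs, Cor. 4.8 (§4.5, proof)] -/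
theorem tendsto_norm_add_sub_norm {x : ℕ → E} {u : E} (y : E)
    (hx : Tendsto (fun n => ‖x n‖) atTop atTop)
    (hu : Tendsto (fun n => ‖x n‖⁻¹ • x n) atTop (𝓝 u)) :
    Tendsto (fun n => ‖x n + y‖ - ‖x n‖) atTop (𝓝 ⟪u, y⟫) := by
  -- `‖x + y‖ − ‖x‖ = (2⟪x/‖x‖, y⟫ + ‖y‖²/‖x‖) / (‖x + y‖/‖x‖ + 1)`
  have hpos : ∀ᶠ n in atTop, 0 < ‖x n‖ := hx.eventually (eventually_gt_atTop 0)
  have hinv : Tendsto (fun n => ‖x n‖⁻¹) atTop (𝓝 0) := tendsto_inv_atTop_zero.comp hx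
  have h1 : Tendsto (fun n => ⟪‖x n‖⁻¹ • x n, y⟫) atTop (𝓝 ⟪u, y⟫) :=
    (continuous_inner.comp (continuous_id.prodMk continuous_const)).continuousAt.tendsto.comp hu
  have h2 : Tendsto (fun n => ‖y‖ ^ 2 * ‖x n‖⁻¹) atTop (𝓝 0) := by
    simpa using hinv.const_mul (‖y‖ ^ 2)
  -- `‖x + y‖/‖x‖ → 1`
  have h3 : Tendsto (fun n => ‖x n + y‖ * ‖x n‖⁻¹) atTop (𝓝 1) := by
    have hb : ∀ n, |‖x n + y‖ * ‖x n‖⁻¹ - ‖x n‖ * ‖x n‖⁻¹| ≤ ‖y‖ * ‖x n‖⁻¹ := fun n => by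
      rw [← sub_mul, abs_mul, abs_of_nonneg (inv_nonneg.2 (norm_nonneg _))]
      refine mul_le_mul_of_nonneg_right ?_ (inv_nonneg.2 (norm_nonneg _))
      have := abs_norm_sub_norm_le (x n + y) (x n)
      simpa using this
    have hc : Tendsto (fun n => ‖x n‖ * ‖x n‖⁻¹) atTop (𝓝 1) := by
      refine tendsto_const_nhds.congr' ?_
      filter_upwards [hpos] with n hn
      rw [mul_inv_cancel₀ hn.ne']
    have hz : Tendsto (fun n => ‖y‖ * ‖x n‖⁻¹) atTop (𝓝 0) := by simpa using hinv.const_mul ‖y‖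
    have hd : Tendsto (fun n => ‖x n + y‖ * ‖x n‖⁻¹ - ‖x n‖ * ‖x n‖⁻¹) atTop (𝓝 0) :=
      squeeze_zero_norm (fun n => by rw [Real.norm_eq_abs]; exact hb n) hz
    have := hd.add hc
    simpa using this
  have hnum : Tendsto (fun n => 2 * ⟪‖x n‖⁻¹ • x n, y⟫ + ‖y‖ ^ 2 * ‖x n‖⁻¹) atTop
      (𝓝 (2 * ⟪u, y⟫ + 0)) := (h1.const_mul 2).add h2
  have hden : Tendsto (fun n => ‖x n + y‖ * ‖x n‖⁻¹ + 1) atTop (𝓝 (1 + 1)) := h3.add_const 1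
  have hq := hnum.div hden (by norm_num)
  rw [add_zero, show 2 * ⟪u, y⟫ / (1 + 1) = ⟪u, y⟫ by ring] at hq
  refine hq.congr' ?_
  filter_upwards [hpos] with n hn
  have hxy : 0 < ‖x n + y‖ + ‖x n‖ := by positivity
  have key : (‖x n + y‖ - ‖x n‖) * (‖x n + y‖ + ‖x n‖) = 2 * ⟪x n, y⟫ + ‖y‖ ^ 2 := by
    have e1 : ‖x n + y‖ ^ 2 = ‖x n‖ ^ 2 + 2 * ⟪x n, y⟫ + ‖y‖ ^ 2 := norm_add_sq_real _ _
    nlinarith [e1]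
  show (2 * ⟪‖x n‖⁻¹ • x n, y⟫ + ‖y‖ ^ 2 * ‖x n‖⁻¹) / (‖x n + y‖ * ‖x n‖⁻¹ + 1) = ‖x n + y‖ - ‖x n‖
  rw [real_inner_smul_left, eq_comm, eq_div_iff (by positivity)]
  field_simp
  nlinarith [key]

omit [InnerProductSpace ℝ E] [FiniteDimensional ℝ E] [MeasurableSpace E] [BorelSpace E] in
/-- `‖x_n + y‖/‖x_n‖ → 1` when `‖x_n‖ → ∞`. [folklore] -/
private theorem tendsto_norm_add_mul_inv_norm {x : ℕ → E} (y : E)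
    (hx : Tendsto (fun n => ‖x n‖) atTop atTop) :
    Tendsto (fun n => ‖x n + y‖ * ‖x n‖⁻¹) atTop (𝓝 1) := by
  have hpos : ∀ᶠ n in atTop, 0 < ‖x n‖ := hx.eventually (eventually_gt_atTop 0)
  have hinv : Tendsto (fun n => ‖x n‖⁻¹) atTop (𝓝 0) := tendsto_inv_atTop_zero.comp hx
  have hb : ∀ n, |‖x n + y‖ * ‖x n‖⁻¹ - ‖x n‖ * ‖x n‖⁻¹| ≤ ‖y‖ * ‖x n‖⁻¹ := fun n => by
    rw [← sub_mul, abs_mul, abs_of_nonneg (inv_nonneg.2 (norm_nonneg _))]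
    refine mul_le_mul_of_nonneg_right ?_ (inv_nonneg.2 (norm_nonneg _))
    have := abs_norm_sub_norm_le (x n + y) (x n)
    simpa using this
  have hc : Tendsto (fun n => ‖x n‖ * ‖x n‖⁻¹) atTop (𝓝 1) := by
    refine tendsto_const_nhds.congr' ?_
    filter_upwards [hpos] with n hn
    rw [mul_inv_cancel₀ hn.ne']
  have hz : Tendsto (fun n => ‖y‖ * ‖x n‖⁻¹) atTop (𝓝 0) := by simpa using hinv.const_mul ‖y‖
  have hd : Tendsto (fun n => ‖x n + y‖ * ‖x n‖⁻¹ - ‖x n‖ * ‖x n‖⁻¹) atTop (𝓝 0) :=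
    squeeze_zero_norm (fun n => by rw [Real.norm_eq_abs]; exact hb n) hz
  have := hd.add hc
  simpa using this

omit [InnerProductSpace ℝ E] [FiniteDimensional ℝ E] [MeasurableSpace E] [BorelSpace E] in
/-- A sequence with `‖x_n‖ → ∞` tends to the cobounded filter, and so does `x_n + y`. [folklore] -/
private theorem tendsto_add_cobounded {x : ℕ → E} (y : E) (hx : Tendsto (fun n => ‖x n‖) atTop atTop) :
    Tendsto (fun n => x n + y) atTop (cobounded E) := by
  rw [← comap_norm_atTop, tendsto_comap_iff]
  have h : Tendsto (fun n => ‖x n‖ + -‖y‖) atTop atTop := tendsto_atTop_add_const_right _ _ hx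
  refine tendsto_atTop_mono (fun n => ?_) h
  have := norm_sub_le (x n + y) y
  simp only [add_sub_cancel_right, Function.comp_apply] at this ⊢
  linarith

omit [FiniteDimensional ℝ E] [MeasurableSpace E] [BorelSpace E] in
/-- The ratio of the asymptotic equivalents: `A(z')/A(z) = e^{−m(‖z'‖ − ‖z‖)} (‖z‖/‖z'‖)^q`. [folklore] -/
private theorem asymp_div {m P Q q : ℝ} (hP : 0 < P) (hQ : 0 < Q) {a b : ℝ} (ha : 0 < a) (hb : 0 < b) :
    P * Real.exp (-(m * a)) / (Q * a ^ q) / (P * Real.exp (-(m * b)) / (Q * b ^ q)) =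
      Real.exp (-(m * (a - b))) * ((a * b⁻¹)⁻¹) ^ q := by
  have haq : 0 < a ^ q := Real.rpow_pos_of_pos ha q
  have hbq : 0 < b ^ q := Real.rpow_pos_of_pos hb q
  rw [show (a * b⁻¹)⁻¹ = b / a by rw [mul_inv, inv_inv, mul_comm, div_eq_mul_inv],
    Real.div_rpow hb.le ha.le,
    show -(m * (a - b)) = -(m * a) - -(m * b) by ring, Real.exp_sub]
  field_simp

omit [FiniteDimensional ℝ E] [MeasurableSpace E] [BorelSpace E] in
/-- **Chatterjee 2026, Corollary 4.8**: if `‖x_n‖ → ∞` and `x_n/‖x_n‖ → u`, then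
`K_λ(x_n + y)/K_λ(x_n) → e^{−√λ u·y}` for every `y`. Proof as printed: Lemma 4.7 (here the hypothesis
`h47`, the tree's `kernelK_asymptotics_holds`) and `‖x + y‖ − ‖x‖ = x·y/‖x‖ + O(‖x‖⁻¹)`
(`tendsto_norm_add_sub_norm`). [cite: Chatterjee2026YMHiggs, Cor. 4.8 (§4.5)] -/
theorem tendsto_kernelK_add_div {m : ℝ} (hm : 0 < m)
    (h47 : Tendsto (fun x : E =>
        (∫ t in Ioi (0 : ℝ), Real.exp (-m ^ 2 * t) * heatKernel t x) /
          (m ^ (((Module.finrank ℝ E : ℝ) - 3) / 2) * Real.exp (-(m * ‖x‖)) /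
            (2 * (2 * Real.pi) ^ (((Module.finrank ℝ E : ℝ) - 1) / 2) *
              ‖x‖ ^ (((Module.finrank ℝ E : ℝ) - 1) / 2))))
      (cobounded E) (𝓝 1))
    {x : ℕ → E} {u : E} (hx : Tendsto (fun n => ‖x n‖) atTop atTop)
    (hu : Tendsto (fun n => ‖x n‖⁻¹ • x n) atTop (𝓝 u)) (y : E) :
    Tendsto (fun n => (∫ t in Ioi (0 : ℝ), Real.exp (-m ^ 2 * t) * heatKernel t (x n + y)) /
        (∫ t in Ioi (0 : ℝ), Real.exp (-m ^ 2 * t) * heatKernel t (x n)))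
      atTop (𝓝 (Real.exp (-(m * ⟪u, y⟫)))) := by
  set K : E → ℝ := fun z => ∫ t in Ioi (0 : ℝ), Real.exp (-m ^ 2 * t) * heatKernel t z with hK
  set q : ℝ := ((Module.finrank ℝ E : ℝ) - 1) / 2 with hq
  set P : ℝ := m ^ (((Module.finrank ℝ E : ℝ) - 3) / 2) with hP
  set Q : ℝ := 2 * (2 * Real.pi) ^ q with hQ
  set A : E → ℝ := fun z => P * Real.exp (-(m * ‖z‖)) / (Q * ‖z‖ ^ q) with hA
  have hP0 : 0 < P := by rw [hP]; positivity
  have hQ0 : 0 < Q := by rw [hQ]; positivity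
  have hApos : ∀ z : E, z ≠ 0 → 0 < A z := fun z hz => by
    have := norm_pos_iff.2 hz
    simp only [hA]
    positivity
  -- Lemma 4.7 along `x_n` and along `x_n + y`
  have hx0 : Tendsto x atTop (cobounded E) := by
    have := tendsto_add_cobounded (0 : E) hx
    simpa using this
  have h0 : Tendsto (fun n => K (x n) / A (x n)) atTop (𝓝 1) := h47.comp hx0
  have hy : Tendsto (fun n => K (x n + y) / A (x n + y)) atTop (𝓝 1) :=
    h47.comp (tendsto_add_cobounded y hx)
  -- the ratio of the asymptotic equivalents
  have hratio : Tendsto (fun n => A (x n + y) / A (x n)) atTop (𝓝 (Real.exp (-(m * ⟪u, y⟫)))) := by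
    have h1 : Tendsto (fun n => Real.exp (-(m * (‖x n + y‖ - ‖x n‖)))) atTop
        (𝓝 (Real.exp (-(m * ⟪u, y⟫)))) :=
      (Real.continuous_exp.tendsto _).comp ((tendsto_norm_add_sub_norm y hx hu).const_mul m).neg
    have h2 : Tendsto (fun n => ((‖x n + y‖ * ‖x n‖⁻¹)⁻¹) ^ q) atTop (𝓝 1) := by
      have h := ((tendsto_norm_add_mul_inv_norm y hx).inv₀ one_ne_zero).rpow_const (p := q)
        (Or.inl (by norm_num))
      simpa using h
    have h3 := h1.mul h2
    rw [mul_one] at h3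
    refine h3.congr' ?_
    have hpos : ∀ᶠ n in atTop, 0 < ‖x n‖ := hx.eventually (eventually_gt_atTop 0)
    have hpos' : ∀ᶠ n in atTop, 0 < ‖x n + y‖ :=
      (tendsto_norm_cobounded_atTop.comp (tendsto_add_cobounded y hx)).eventually (eventually_gt_atTop 0)
    filter_upwards [hpos, hpos'] with n hn hn'
    simp only [hA]
    exact (asymp_div (m := m) (q := q) hP0 hQ0 hn' hn).symm
  -- assemble: `K(x+y)/K(x) = (R(x+y)/R(x)) · (A(x+y)/A(x))`
  have h4 := (hy.div h0 one_ne_zero).mul hratio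
  rw [div_one, one_mul] at h4
  refine h4.congr' ?_
  have hne : ∀ᶠ n in atTop, x n ≠ 0 := hx0.eventually (eventually_ne_cobounded (0 : E))
  have hne' : ∀ᶠ n in atTop, x n + y ≠ 0 :=
    (tendsto_add_cobounded y hx).eventually (eventually_ne_cobounded (0 : E))
  have hK0 : ∀ᶠ n in atTop, K (x n) ≠ 0 := by
    have := h0.eventually (eventually_ne_nhds one_ne_zero)
    filter_upwards [this] with n hn h0'
    exact hn (by rw [h0', zero_div])
  filter_upwards [hne, hne', hK0] with n hn hn' hKn
  have hA1 := (hApos _ hn).ne'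
  have hA2 := (hApos _ hn').ne'
  show (K (x n + y) / A (x n + y)) / (K (x n) / A (x n)) * (A (x n + y) / A (x n)) =
    K (x n + y) / K (x n)
  field_simp

omit [FiniteDimensional ℝ E] [MeasurableSpace E] [BorelSpace E] in
/-- **The uniform bound behind the dominated convergence of Lemma 4.9**: for every radius `V` there
are `N` and `C` such that `0 < K(x_n)` and `K(v + x_n)/K(x_n) ≤ C` for all `n ≥ N` and `‖v‖ ≤ V`
(from Lemma 4.7: `K/A ∈ [1/2, 3/2]` far out, and `A(x + v)/A(x) ≤ 2^q e^{mV}` for `‖x‖ ≥ 2V`).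
[cite: Chatterjee2026YMHiggs, Lemma 4.9 (§4.5, proof: «By the dominated convergence theorem»)] -/
theorem exists_kernelK_translate_div_le {m : ℝ} (hm : 0 < m)
    (h47 : Tendsto (fun x : E =>
        (∫ t in Ioi (0 : ℝ), Real.exp (-m ^ 2 * t) * heatKernel t x) /
          (m ^ (((Module.finrank ℝ E : ℝ) - 3) / 2) * Real.exp (-(m * ‖x‖)) /
            (2 * (2 * Real.pi) ^ (((Module.finrank ℝ E : ℝ) - 1) / 2) *
              ‖x‖ ^ (((Module.finrank ℝ E : ℝ) - 1) / 2))))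
      (cobounded E) (𝓝 1))
    {x : ℕ → E} (hx : Tendsto (fun n => ‖x n‖) atTop atTop) (hd : 1 ≤ Module.finrank ℝ E) (V : ℝ) :
    ∃ (N : ℕ) (C : ℝ), 0 ≤ C ∧ ∀ n, N ≤ n →
      0 < (∫ t in Ioi (0 : ℝ), Real.exp (-m ^ 2 * t) * heatKernel t (x n)) ∧
      ∀ v : E, ‖v‖ ≤ V →
        (∫ t in Ioi (0 : ℝ), Real.exp (-m ^ 2 * t) * heatKernel t (v + x n)) /
            (∫ t in Ioi (0 : ℝ), Real.exp (-m ^ 2 * t) * heatKernel t (x n)) ≤ C := by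
  set K : E → ℝ := fun z => ∫ t in Ioi (0 : ℝ), Real.exp (-m ^ 2 * t) * heatKernel t z with hK
  set q : ℝ := ((Module.finrank ℝ E : ℝ) - 1) / 2 with hq
  set P : ℝ := m ^ (((Module.finrank ℝ E : ℝ) - 3) / 2) with hP
  set Q : ℝ := 2 * (2 * Real.pi) ^ q with hQ
  set A : E → ℝ := fun z => P * Real.exp (-(m * ‖z‖)) / (Q * ‖z‖ ^ q) with hA
  have hq0 : 0 ≤ q := by
    rw [hq]
    have : (1 : ℝ) ≤ Module.finrank ℝ E := by exact_mod_cast hd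
    linarith
  have hP0 : 0 < P := by rw [hP]; positivity
  have hQ0 : 0 < Q := by rw [hQ]; positivity
  have hApos : ∀ z : E, z ≠ 0 → 0 < A z := fun z hz => by
    have := norm_pos_iff.2 hz
    simp only [hA]
    positivity
  -- Lemma 4.7, uniformly far out: `|K/A − 1| < 1/2` for `‖z‖ ≥ R₀`
  obtain ⟨R₀, hR₀⟩ : ∃ R₀ : ℝ, ∀ z : E, R₀ ≤ ‖z‖ → |K z / A z - 1| < 1 / 2 := by
    have h := Metric.tendsto_nhds.1 h47 (1 / 2) (by norm_num)
    rw [← comap_norm_atTop, eventually_comap] at h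
    obtain ⟨R₀, hR₀⟩ := eventually_atTop.1 h
    refine ⟨R₀, fun z hz => ?_⟩
    have h := hR₀ ‖z‖ hz z rfl
    rw [Real.dist_eq] at h
    exact h
  -- the threshold
  obtain ⟨N, hN⟩ := eventually_atTop.1 (hx.eventually (eventually_ge_atTop (max R₀ 0 + 2 * max V 0 + 1)))
  refine ⟨N, 3 * (2 : ℝ) ^ q * Real.exp (m * max V 0), by positivity, fun n hn => ?_⟩
  have hxn : max R₀ 0 + 2 * max V 0 + 1 ≤ ‖x n‖ := hN n hn
  have hV0 : 0 ≤ max V 0 := le_max_right _ _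
  have hxpos : 0 < ‖x n‖ := by linarith [le_max_right R₀ 0]
  have hxne : x n ≠ 0 := norm_pos_iff.1 hxpos
  have hRx : R₀ ≤ ‖x n‖ := by linarith [le_max_left R₀ 0]
  have hKx : 1 / 2 * A (x n) ≤ K (x n) := by
    have h := hR₀ (x n) hRx
    rw [abs_lt] at h
    have hA0 := hApos _ hxne
    have : 1 / 2 < K (x n) / A (x n) := by linarith [h.1]
    rw [lt_div_iff₀ hA0] at this
    linarith
  have hKpos : 0 < K (x n) := lt_of_lt_of_le (by have := hApos _ hxne; positivity) hKx
  refine ⟨hKpos, fun v hv => ?_⟩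
  have hvV : ‖v‖ ≤ max V 0 := hv.trans (le_max_left _ _)
  -- `‖v + x_n‖ ≥ ‖x_n‖ − V ≥ R₀` and `≥ ‖x_n‖/2`
  have hnorm : ‖x n‖ - max V 0 ≤ ‖v + x n‖ := by
    have := norm_sub_le (v + x n) v
    simp only [add_sub_cancel_left] at this
    linarith
  have hvx_pos : 0 < ‖v + x n‖ := by linarith [le_max_right R₀ 0]
  have hvx_ne : v + x n ≠ 0 := norm_pos_iff.1 hvx_pos
  have hRvx : R₀ ≤ ‖v + x n‖ := by linarith [le_max_left R₀ 0]
  have hKvx : K (v + x n) ≤ 3 / 2 * A (v + x n) := by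
    have h := hR₀ (v + x n) hRvx
    rw [abs_lt] at h
    have hA0 := hApos _ hvx_ne
    have : K (v + x n) / A (v + x n) < 3 / 2 := by linarith [h.2]
    rw [div_lt_iff₀ hA0] at this
    linarith
  -- the ratio of the asymptotic equivalents is bounded
  have hAratio : A (v + x n) / A (x n) ≤ (2 : ℝ) ^ q * Real.exp (m * max V 0) := by
    simp only [hA]
    rw [asymp_div (m := m) (q := q) hP0 hQ0 hvx_pos hxpos, mul_comm]
    refine mul_le_mul ?_ ?_ (Real.exp_nonneg _) (by positivity)
    · -- `(‖x‖/‖x + v‖)^q ≤ 2^q`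
      refine Real.rpow_le_rpow (by positivity) ?_ hq0
      rw [mul_inv, inv_inv, inv_mul_le_iff₀ hvx_pos]
      linarith [le_max_right R₀ 0]
    · exact Real.exp_le_exp.2 (by nlinarith [hnorm, hm])
  calc K (v + x n) / K (x n) ≤ (3 / 2 * A (v + x n)) / (1 / 2 * A (x n)) := by
        have hA0 := hApos _ hxne
        exact div_le_div₀ (by have := hApos _ hvx_ne; positivity) hKvx (by positivity) hKx
    _ = 3 * (A (v + x n) / A (x n)) := by
        have hA0 := (hApos _ hxne).ne'
        field_simp
    _ ≤ 3 * ((2 : ℝ) ^ q * Real.exp (m * max V 0)) := mul_le_mul_of_nonneg_left hAratio (by norm_num)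
    _ = 3 * (2 : ℝ) ^ q * Real.exp (m * max V 0) := by ring

/-! ### Lemma 4.9: `∫ f K g^{x_n} / K(x_n) → I(f, g, u)` -/

omit [InnerProductSpace ℝ E] [FiniteDimensional ℝ E] [MeasurableSpace E] [BorelSpace E] in
/-- A compactly supported function vanishes outside some ball. [folklore] -/
private theorem eq_zero_of_norm_gt_of_hasCompactSupport {f : E → ℝ} (hf : HasCompactSupport f) :
    ∃ R : ℝ, 0 ≤ R ∧ ∀ y, R < ‖y‖ → f y = 0 := by
  obtain ⟨R, hR⟩ := (hf.isCompact.isBounded).subset_closedBall 0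
  refine ⟨max R 0, le_max_right _ _, fun y hy => ?_⟩
  by_contra h
  have : y ∈ tsupport f := subset_tsupport _ (Function.mem_support.2 h)
  have := hR this
  rw [mem_closedBall_zero_iff] at this
  linarith [le_max_left R 0]

omit [FiniteDimensional ℝ E] [MeasurableSpace E] [BorelSpace E] in
/-- Schwartz functions are bounded. [folklore] -/
private theorem schwartz_exists_abs_le (f : 𝓢(E, ℝ)) : ∃ B : ℝ, 0 ≤ B ∧ ∀ y, |f y| ≤ B :=
  ⟨‖f.toBoundedContinuousFunction‖, norm_nonneg _, fun y => by
    have := f.toBoundedContinuousFunction.norm_coe_le_norm y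
    simpa [Real.norm_eq_abs] using this⟩

/-- **Chatterjee 2026, Lemma 4.9**: for compactly supported `f, g` and `x_n` with `‖x_n‖ → ∞`,
`x_n/‖x_n‖ → u`,
`∫ f(y) (∫ K(v + x_n) g(y − v) dv) dy / K(x_n) → ∫∫ f(y) g(y − v) e^{−√λ u·v} dv dy = I(f, g, u, λ)`
(`massProfile`). Proof as printed: Corollary 4.8 (`tendsto_kernelK_add_div`) pointwise in `v`, the
uniform bound `exists_kernelK_translate_div_le` on the compact set where `f(y)g(y − v) ≠ 0`, and
dominated convergence (on `E × E`). The hypothesis `h47` is Lemma 4.7 (`kernelK_asymptotics_holds`).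
[cite: Chatterjee2026YMHiggs, Lemma 4.9 (§4.5)] -/
theorem tendsto_integral_kernelK_translate_div {m : ℝ} (hm : 0 < m)
    (h47 : Tendsto (fun x : E =>
        (∫ t in Ioi (0 : ℝ), Real.exp (-m ^ 2 * t) * heatKernel t x) /
          (m ^ (((Module.finrank ℝ E : ℝ) - 3) / 2) * Real.exp (-(m * ‖x‖)) /
            (2 * (2 * Real.pi) ^ (((Module.finrank ℝ E : ℝ) - 1) / 2) *
              ‖x‖ ^ (((Module.finrank ℝ E : ℝ) - 1) / 2))))
      (cobounded E) (𝓝 1))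
    (hd : 1 ≤ Module.finrank ℝ E) {x : ℕ → E} {u : E}
    (hx : Tendsto (fun n => ‖x n‖) atTop atTop) (hu : Tendsto (fun n => ‖x n‖⁻¹ • x n) atTop (𝓝 u))
    {f g : 𝓢(E, ℝ)} (hf : HasCompactSupport f) (hg : HasCompactSupport g) :
    Tendsto (fun n =>
        (∫ y, f y * ∫ v, (∫ t in Ioi (0 : ℝ), Real.exp (-m ^ 2 * t) * heatKernel t (v + x n)) *
            g (y - v)) /
          (∫ t in Ioi (0 : ℝ), Real.exp (-m ^ 2 * t) * heatKernel t (x n)))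
      atTop (𝓝 (massProfile m u f g)) := by
  set K : E → ℝ := fun z => ∫ t in Ioi (0 : ℝ), Real.exp (-m ^ 2 * t) * heatKernel t z with hK
  have hKnn : ∀ z, 0 ≤ K z := fun z => freeKernel_nonneg m z
  have hKint : Integrable K := integrable_freeKernel hm.ne'
  obtain ⟨Rf, hRf0, hRf⟩ := eq_zero_of_norm_gt_of_hasCompactSupport (E := E) hf
  obtain ⟨Rg, hRg0, hRg⟩ := eq_zero_of_norm_gt_of_hasCompactSupport (E := E) hg
  obtain ⟨Bf, hBf0, hBf⟩ := schwartz_exists_abs_le f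
  obtain ⟨Bg, hBg0, hBg⟩ := schwartz_exists_abs_le g
  set V : ℝ := Rf + Rg with hV
  obtain ⟨N, C, hC0, hNC⟩ := exists_kernelK_translate_div_le hm h47 hx hd V
  -- the support of `(y, v) ↦ f(y) g(y − v)`
  set S : Set (E × E) := closedBall (0 : E) Rf ×ˢ closedBall (0 : E) V with hS
  have hSmeas : MeasurableSet S := measurableSet_closedBall.prod measurableSet_closedBall
  have hSfin : ((volume : Measure E).prod volume) S < ⊤ :=
    ((isCompact_closedBall _ _).prod (isCompact_closedBall _ _)).measure_lt_top
  have hfg0 : ∀ p : E × E, p ∉ S → f p.1 * g (p.1 - p.2) = 0 := by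
    intro p hp
    by_cases hf1 : Rf < ‖p.1‖
    · rw [hRf _ hf1, zero_mul]
    · have hp2 : V < ‖p.2‖ := by
        simp only [hS, mem_prod, mem_closedBall_zero_iff, not_and_or, not_le] at hp
        exact hp.resolve_left hf1
      have h12 : Rg < ‖p.1 - p.2‖ := by
        have h := norm_sub_le p.1 (p.1 - p.2)
        rw [sub_sub_cancel] at h
        linarith [not_lt.1 hf1]
      rw [hRg _ h12, mul_zero]
  -- the integrands
  set H : ℕ → E × E → ℝ := fun n p => f p.1 * g (p.1 - p.2) * K (p.2 + x n) * (K (x n))⁻¹ with hH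
  set Hlim : E × E → ℝ := fun p => f p.1 * g (p.1 - p.2) * Real.exp (-(m * ⟪u, p.2⟫)) with hHlim
  have hcont : Continuous fun p : E × E => f p.1 * g (p.1 - p.2) :=
    (f.continuous.comp continuous_fst).mul (g.continuous.comp (continuous_fst.sub continuous_snd))
  have hKsnd : ∀ n, AEStronglyMeasurable (fun p : E × E => K (p.2 + x n))
      ((volume : Measure E).prod volume) := fun n =>
    (hKint.aestronglyMeasurable.comp_measurePreserving
      (measurePreserving_add_right volume (x n))).comp_quasiMeasurePreserving
      Measure.quasiMeasurePreserving_snd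
  have hHmeas : ∀ n, AEStronglyMeasurable (H n) ((volume : Measure E).prod volume) := fun n =>
    ((hcont.aestronglyMeasurable.mul (hKsnd n)).mul aestronglyMeasurable_const)
  -- dominated convergence on `E × E`
  have hDCT : Tendsto (fun n => ∫ p, H n p ∂((volume : Measure E).prod volume)) atTop
      (𝓝 (∫ p, Hlim p ∂((volume : Measure E).prod volume))) := by
    refine tendsto_integral_filter_of_dominated_convergence (S.indicator fun _ => Bf * Bg * C)
      (Eventually.of_forall hHmeas) ?_ ?_ ?_
    · filter_upwards [eventually_ge_atTop N] with n hn
      obtain ⟨hKpos, hC⟩ := hNC n hn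
      refine ae_of_all _ fun p => ?_
      by_cases hp : p ∈ S
      · rw [indicator_of_mem hp]
        have hv : ‖p.2‖ ≤ V := (mem_closedBall_zero_iff.1 (mem_prod.1 hp).2)
        have hρ := hC p.2 hv
        have hρ0 : 0 ≤ K (p.2 + x n) * (K (x n))⁻¹ := mul_nonneg (hKnn _) (inv_nonneg.2 hKpos.le)
        simp only [hH, Real.norm_eq_abs]
        rw [abs_mul, abs_mul, abs_mul, abs_of_nonneg (hKnn _), abs_of_nonneg (inv_nonneg.2 hKpos.le)]
        calc |f p.1| * |g (p.1 - p.2)| * K (p.2 + x n) * (K (x n))⁻¹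
            = |f p.1| * |g (p.1 - p.2)| * (K (p.2 + x n) / K (x n)) := by ring
          _ ≤ Bf * Bg * C := by
            refine mul_le_mul (mul_le_mul (hBf _) (hBg _) (abs_nonneg _) hBf0) hρ
              (div_nonneg (hKnn _) hKpos.le) (by positivity)
      · rw [indicator_of_notMem hp]
        simp only [hH, mul_assoc]
        rw [← mul_assoc, hfg0 p hp, zero_mul, norm_zero]
    · exact (integrableOn_const hSfin.ne).integrable_indicator hSmeas
    · refine ae_of_all _ fun p => ?_
      simp only [hH, hHlim]
      have h := (tendsto_kernelK_add_div hm h47 hx hu p.2).const_mul (f p.1 * g (p.1 - p.2))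
      refine h.congr' (Eventually.of_forall fun n => ?_)
      simp only [add_comm (x n) p.2, div_eq_mul_inv]
      ring
  -- the left-hand sides are the product integrals of `H n`
  have hL : ∀ n, (∫ y, f y * ∫ v, K (v + x n) * g (y - v)) / K (x n) =
      ∫ p, H n p ∂((volume : Measure E).prod volume) := by
    intro n
    have hGint : Integrable (fun p : E × E => f p.1 * g (p.1 - p.2) * K (p.2 + x n))
        ((volume : Measure E).prod volume) := by
      have hprod : Integrable (fun p : E × E => |f p.1| * (Bg * K (p.2 + x n)))
          ((volume : Measure E).prod volume) :=
        Integrable.mul_prod f.integrable.abs ((hKint.comp_add_right (x n)).const_mul Bg)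
      refine hprod.mono' (hcont.aestronglyMeasurable.mul (hKsnd n)) (ae_of_all _ fun p => ?_)
      rw [Real.norm_eq_abs, abs_mul, abs_mul, abs_of_nonneg (hKnn _), mul_assoc]
      exact mul_le_mul_of_nonneg_left (mul_le_mul_of_nonneg_right (hBg _) (hKnn _))
        (abs_nonneg _)
    simp only [hH]
    rw [integral_mul_const, integral_prod _ hGint, ← div_eq_mul_inv]
    congr 1
    refine integral_congr_ae (ae_of_all _ fun y => ?_)
    simp only
    rw [← integral_const_mul]
    refine integral_congr_ae (ae_of_all _ fun v => ?_)
    simp only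
    ring
  -- the right-hand side is the product integral of `Hlim`
  have hR : massProfile m u f g = ∫ p, Hlim p ∂((volume : Measure E).prod volume) := by
    have hint : Integrable Hlim ((volume : Measure E).prod volume) := by
      have hbound : Integrable (S.indicator fun _ => Bf * Bg * Real.exp (m * ‖u‖ * V))
          ((volume : Measure E).prod volume) :=
        (integrableOn_const hSfin.ne).integrable_indicator hSmeas
      refine hbound.mono'
        (hcont.mul ((Real.continuous_exp.comp ((continuous_const.mul
          (continuous_const.inner continuous_snd)).neg)))).aestronglyMeasurable
        (ae_of_all _ fun p => ?_)
      by_cases hp : p ∈ S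
      · rw [indicator_of_mem hp]
        have hv : ‖p.2‖ ≤ V := (mem_closedBall_zero_iff.1 (mem_prod.1 hp).2)
        simp only [hHlim, Real.norm_eq_abs]
        rw [abs_mul, abs_mul, Real.abs_exp]
        refine mul_le_mul (mul_le_mul (hBf _) (hBg _) (abs_nonneg _) hBf0)
          (Real.exp_le_exp.2 ?_) (Real.exp_nonneg _) (by positivity)
        have h1 := abs_real_inner_le_norm u p.2
        have h2 : -(m * ⟪u, p.2⟫) ≤ m * |⟪u, p.2⟫| := by nlinarith [neg_abs_le ⟪u, p.2⟫]
        refine h2.trans ?_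
        rw [mul_assoc]
        exact mul_le_mul_of_nonneg_left (h1.trans (mul_le_mul_of_nonneg_left hv (norm_nonneg _)))
          hm.le
      · rw [indicator_of_notMem hp]
        simp only [hHlim]
        rw [hfg0 p hp, zero_mul, norm_zero]
    rw [massProfile, integral_prod _ hint]
  rw [hR]
  exact hDCT.congr (fun n => (hL n).symm)

/-! ### Lemma 2.6: the mass of the Euclidean Proca field -/

omit [FiniteDimensional ℝ E] [MeasurableSpace E] [BorelSpace E] in
/-- `∂_v` commutes with translations on Schwartz space («`K_λ`, derivatives and translations
commute», §4.5). [cite: Chatterjee2026YMHiggs, §4.5 (end of the proof of Lemma 2.6)] -/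
theorem lineDerivOp_translateTest (v a : E) (ψ : 𝓢(E, ℝ)) :
    (∂_{v} (translateTest a ψ) : 𝓢(E, ℝ)) = translateTest a (∂_{v} ψ) := by
  ext y
  have hcoe : ((translateTest a ψ : 𝓢(E, ℝ)) : E → ℝ) = fun z => ψ (z - a) :=
    funext (translateTest_apply a ψ)
  rw [SchwartzMap.lineDerivOp_apply_eq_fderiv, hcoe, fderiv_comp_sub, translateTest_apply,
    SchwartzMap.lineDerivOp_apply_eq_fderiv]

omit [FiniteDimensional ℝ E] [MeasurableSpace E] [BorelSpace E] in
/-- The directional derivative of a compactly supported test function is compactly supported.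
[folklore] -/
private theorem hasCompactSupport_lineDerivOp {φ : 𝓢(E, ℝ)} (hφ : HasCompactSupport φ) (v : E) :
    HasCompactSupport ((∂_{v} φ : 𝓢(E, ℝ)) : E → ℝ) := by
  have hcoe : ((∂_{v} φ : 𝓢(E, ℝ)) : E → ℝ) = fun y => fderiv ℝ φ y v :=
    funext (SchwartzMap.lineDerivOp_apply_eq_fderiv v φ)
  rw [hcoe]
  exact hφ.fderiv_apply (𝕜 := ℝ) v

/-- **The covariance against a translate, in the form of Lemma 4.9**:
`C_m(f, g^{a}) = ∫ f(y) (∫ K(v + a) g(y − v) dv) dy`, `g^a = translateTest (−a) g`.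
[cite: Chatterjee2026YMHiggs, Lemma 4.9 (§4.5, proof, (4.11))] -/
theorem freeCovarianceReal_translateTest_eq {m : ℝ} (hm : m ≠ 0) (f g : 𝓢(E, ℝ)) (a : E) :
    freeCovarianceReal m f (translateTest (-a) g) =
      ∫ y, f y * ∫ v, (∫ t in Ioi (0 : ℝ), Real.exp (-m ^ 2 * t) * heatKernel t (v + a)) *
        g (y - v) := by
  rw [freeCovarianceReal_eq_integral_kernel hm]
  refine integral_congr_ae (ae_of_all _ fun y => ?_)
  simp only
  rw [integral_kernel_translateTest]

/-- **Chatterjee 2026, Lemma 2.6** — discharge of the named fact `procaComponent_correlationDecay`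
(the mass of the Euclidean Proca field is `√λ = m`): for `d ≥ 2`, `m > 0`, a direction `v`,
compactly supported `φ, ψ`, and `x_n` with `‖x_n‖ → ∞`, `x_n/‖x_n‖ → u`,
`P_{m,v}(φ, ψ^{x_n}) / (‖x_n‖^{−(d−1)/2} e^{−m‖x_n‖}) → m^{(d−3)/2}/(2(2π)^{(d−1)/2}) ·
(‖v‖² I(φ, ψ, u) + m⁻² I(∂_vφ, ∂_vψ, u))`. Proof as printed (§4.5): `P_{m,v}(φ, ψ^x) =
‖v‖² C(φ, ψ^x) + m⁻² C(∂φ, (∂ψ)^x)` (derivatives commute with translations), each term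
`= K(x_n) · (∫ f K g^{x_n}/K(x_n))` with Lemma 4.9, and `K(x_n)/(‖x_n‖^{−(d−1)/2}e^{−m‖x_n‖}) →
m^{(d−3)/2}/(2(2π)^{(d−1)/2})` by Lemma 4.7. [cite: Chatterjee2026YMHiggs, Lemma 2.6 (§2.4; proof §4.5)] -/
theorem procaComponent_correlationDecay_holds : procaComponent_correlationDecay E := by
  intro hd m hm v φ ψ hφ hψ x u _ hx hxu
  have hd1 : 1 ≤ Module.finrank ℝ E := le_trans (by norm_num) hd
  have h47 := kernelK_asymptotics_holds (E := E) hd m hm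
  set K : E → ℝ := fun z => ∫ t in Ioi (0 : ℝ), Real.exp (-m ^ 2 * t) * heatKernel t z with hK
  set q : ℝ := ((Module.finrank ℝ E : ℝ) - 1) / 2 with hq
  set P : ℝ := m ^ (((Module.finrank ℝ E : ℝ) - 3) / 2) with hP
  set Q : ℝ := 2 * (2 * Real.pi) ^ q with hQ
  have hP0 : 0 < P := by rw [hP]; positivity
  have hQ0 : 0 < Q := by rw [hQ]; positivity
  -- Lemma 4.9, twice
  have h1 := tendsto_integral_kernelK_translate_div hm h47 hd1 hx hxu hφ hψ
  have h2 := tendsto_integral_kernelK_translate_div hm h47 hd1 hx hxu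
    (hasCompactSupport_lineDerivOp hφ v) (hasCompactSupport_lineDerivOp hψ v)
  -- Lemma 4.7: `K(x_n)/(‖x_n‖^{−q} e^{−m‖x_n‖}) → P/Q`
  have hx0 : Tendsto x atTop (cobounded E) := by
    have := tendsto_add_cobounded (0 : E) hx
    simpa using this
  have h3 : Tendsto (fun n => K (x n) / (‖x n‖ ^ (-q) * Real.exp (-(m * ‖x n‖)))) atTop
      (𝓝 (P / Q)) := by
    have h := (h47.comp hx0).mul_const (P / Q)
    rw [one_mul] at h
    refine h.congr' ?_
    filter_upwards [hx0.eventually (eventually_ne_cobounded 0)] with n hn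
    have hr : 0 < ‖x n‖ := norm_pos_iff.2 hn
    have hrq : 0 < ‖x n‖ ^ q := Real.rpow_pos_of_pos hr q
    simp only [Function.comp_apply, hK]
    rw [Real.rpow_neg hr.le]
    field_simp
  -- eventually `K(x_n) > 0`
  obtain ⟨N, C, -, hN⟩ := exists_kernelK_translate_div_le hm h47 hx hd1 0
  have h4 := h3.mul ((h1.const_mul (‖v‖ ^ 2)).add (h2.const_mul ((m ^ 2)⁻¹)))
  refine h4.congr' ?_
  filter_upwards [eventually_ge_atTop N, hx0.eventually (eventually_ne_cobounded 0)] with n hn hn0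
  have hKpos := (hN n hn).1
  have hr : 0 < ‖x n‖ := norm_pos_iff.2 hn0
  have hD : 0 < ‖x n‖ ^ (-q) * Real.exp (-(m * ‖x n‖)) := by positivity
  rw [procaComponentCovariance_apply, lineDerivOp_translateTest,
    freeCovarianceReal_translateTest_eq hm.ne', freeCovarianceReal_translateTest_eq hm.ne']
  have hK0 : K (x n) ≠ 0 := hKpos.ne'
  simp only [hK] at hK0 ⊢
  field_simp
  simp only [neg_mul] at hK0
  exact mul_div_cancel_left₀ _ hK0

end Literature.MathematicalPhysics.QuantumFieldTheory.Chatterjee2026YMHiggs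

end
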